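import Summits.ResolutionOfSingularities.ResolutionOfSingularities.Theorems.FrobeniusLadderFRationalResolutionFrobeniusPowerAtPrime
import Summits.ResolutionOfSingularities.ResolutionOfSingularities.Theorems.FrobeniusLadderFInjectiveMacaulayficationFedderOrigin
import Summits.ResolutionOfSingularities.ResolutionOfSingularities.Theorems.FrobeniusLadderFInjectiveMacaulayficationFrobeniusClosedLocalizes
import Mathlib.RingTheory.RegularLocalRing.Polynomial
import Mathlib.RingTheory.MvPolynomial.Homogeneous
import Mathlib.RingTheory.Polynomial.Basic
import HarnessLib

/-!
# Fedder's test descends from the vertex of a cone to the charts of its `Proj`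

Support file for crux stmt-ResolutionOfSingularities-15316 (`FrobeniusLadder.FRationalModification`, line
`socle-discrepancy-certificate`, stub `stub_maxMultiplicityCertificate`): the F-purity half of the
certificate on the exceptional divisor of the blow-up of a maximal-multiplicity F-pure hypersurface point.

Let `k` be a field of characteristic `p`, `S = k[T₀, …, T_{r-1}]`, `𝔫 = (T₀, …, T_{r-1})`, and
`B = k[T_j : j ≠ i]` the coordinate ring of the standard chart `D₊(T_i)` of `ℙ^{r-1}_k`, with the
dehomogenization `kill : T_i ↦ 1, T_j ↦ T_j`. **If a form `H ∈ S` does not lie in the Frobenius power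
`𝔫^[p] = (T₀^p, …, T_{r-1}^p)`, then for EVERY prime `Q` of `B` the image of `kill H` in `B_Q` does not
lie in `(Q B_Q)^[p]`** (`coneChart_notMem_frobeniusPower`). Applied to `H = F^(p-1)` for a form `F`:
Fedder's test for the cone `S/(F)` at its vertex implies Fedder's test for the chart `B/(kill F)` of
`Proj S/(F)` at every point — the algebra behind "a graded hypersurface F-pure at the irrelevant ideal is
F-pure, and so is its `Proj`".

Proof. Let `θ : S → B[Z]`, `T_i ↦ Z`, `T_j ↦ Z·T_j` (the cone over the chart) and `P = θ⁻¹(Q[Z])`, a prime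
of `S` with `T_i ∉ P ⊆ 𝔫` (`X_notMem_comapCone`, `comapCone_le`). The Kunz–Fedder transfer along `P ⊆ 𝔫` in
the regular ring `S` (`FRationalResolution.stub_notMem_frobeniusPower_atPrime`) gives `H/1 ∉ (P S_P)^[p]`.
On the other hand `ψ : B → S_P`, `T_j ↦ T_j/T_i`, maps `Q` into `P S_P` and `B ∖ Q` into units
(homogenize: `θ(bʰ) = Z^D b`, `bʰ/1 = (T_i/1)^D ψ(b)`), and `(T_i/1)^D ψ(kill H) = H/1` for a form `H` of
degree `D`; so `kill H / 1 ∈ (Q B_Q)^[p]`, i.e. `m · kill H ∈ Q^[p]` with `m ∉ Q`, would give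
`H/1 ∈ (P S_P)^[p]`. The maps `θ`, `ψ` enter the lemmas as variables with their defining values on the
generators (no auxiliary definitions).

References: R. Fedder, Trans. AMS 278 (1983), Prop. 1.7, Thm. 1.12; E. Kunz, Amer. J. Math. 91 (1969)
(flatness of Frobenius on regular rings, through the tree file above). [folklore]
-/

-- single-problem summit: the doubled namespace component is forced
set_option linter.dupNamespace false

noncomputable section

namespace Summit.ResolutionOfSingularities.ResolutionOfSingularities.Theorems.FRationalModification.MaxMultiplicityCertificateCone

open MvPolynomial IsLocalRing Literature.RingTheory.TightClosure
open Summit.ResolutionOfSingularities.ResolutionOfSingularities.Theorems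

/-! ## Forms rescale: `H(c·a) = c^D · H(a)` -/

/-- A form of degree `D` evaluated at a rescaled point: `H(c a₁, …, c a_r) = c^D H(a₁, …, a_r)`.
[folklore] -/
theorem eval₂_mul_of_isHomogeneous {σ R A : Type*} [CommSemiring R] [CommSemiring A] (f : R →+* A)
    (g : σ → A) (c : A) {H : MvPolynomial σ R} {D : ℕ} (hH : H.IsHomogeneous D) :
    eval₂ f (fun j => c * g j) H = c ^ D * eval₂ f g H := by
  classical
  rw [eval₂_eq, eval₂_eq, Finset.mul_sum]
  refine Finset.sum_congr rfl fun α hα => ?_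
  have hdeg : α.degree = D := by
    by_contra hne
    exact (mem_support_iff.mp hα) (hH.coeff_eq_zero hne)
  rw [Finset.prod_congr rfl fun j _ => mul_pow c (g j) (α j), Finset.prod_mul_distrib,
    Finset.prod_pow_eq_pow_sum, ← Finsupp.degree_apply, hdeg]
  ring

section Chart

variable {k : Type} [Field k] {r : ℕ} (i : Fin r)

local notation3 "S" => MvPolynomial (Fin r) k
local notation3 "B" => MvPolynomial {j : Fin r // j ≠ i} k
/-- Dehomogenization at `T_i`: `T_i ↦ 1`, `T_j ↦ T_j`. -/
local notation3 "kill" => fun j : Fin r =>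
  if h : j = i then (1 : MvPolynomial {j : Fin r // j ≠ i} k) else MvPolynomial.X ⟨j, h⟩

/-! ## The cone `θ : S → B[Z]` over the chart and the prime `P = θ⁻¹(Q[Z])` -/

variable (θ : MvPolynomial (Fin r) k →ₐ[k] Polynomial (MvPolynomial {j : Fin r // j ≠ i} k))
  (hθi : θ (X i) = Polynomial.X)
  (hθj : ∀ j : {j : Fin r // j ≠ i}, θ (X j.1) = Polynomial.X * Polynomial.C (X j))

include hθj in
/-- `θ` on a form `h ∈ B` of degree `d` (through `T_j ↦ T_j`): `θ(h) = Z^d · h`. [folklore] -/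
theorem cone_rename_of_isHomogeneous {h : B} {d : ℕ} (hh : h.IsHomogeneous d) :
    θ (rename Subtype.val h) = Polynomial.X ^ d * Polynomial.C h := by
  have hcomp : (θ.comp (rename Subtype.val) : B →ₐ[k] Polynomial B) =
      aeval fun j : {j : Fin r // j ≠ i} => (Polynomial.X : Polynomial B) * Polynomial.C (X j) := by
    refine algHom_ext fun j => ?_
    rw [AlgHom.comp_apply, aeval_X, rename_X]
    exact hθj j
  have hC : (eval₂Hom (algebraMap k (Polynomial B)) fun j : {j : Fin r // j ≠ i} =>
      Polynomial.C (X j)) = (Polynomial.C : B →+* Polynomial B) := by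
    refine ringHom_ext (fun c => ?_) (fun j => ?_)
    · rw [eval₂Hom_C, Polynomial.algebraMap_apply, algebraMap_eq]
    · rw [eval₂Hom_X']
  have h1 : θ (rename Subtype.val h) = (θ.comp (rename Subtype.val)) h := rfl
  rw [h1, hcomp, aeval_def, eval₂_mul_of_isHomogeneous _ _ _ hh, ← coe_eval₂Hom, hC]

variable (Q : Ideal (MvPolynomial {j : Fin r // j ≠ i} k)) [Q.IsPrime]

/-- `P = θ⁻¹(Q[Z])` is prime (`Q[Z]` is prime). [folklore] -/
theorem isPrime_comapCone : (Ideal.comap θ.toRingHom (Q.map (Polynomial.C : B →+* Polynomial B))).IsPrime := by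
  haveI : (Q.map (Polynomial.C : B →+* Polynomial B)).IsPrime := Ideal.isPrime_map_C_of_isPrime
  exact Ideal.IsPrime.comap _

-- The prime `P = θ⁻¹(Q[Z]) ⊆ S` of the cone over the point `Q` of the chart (a variable pinned by `hP`,
-- so that `S_P` carries its instances).
variable (P : Ideal (MvPolynomial (Fin r) k)) [P.IsPrime]
  (hP : P = Ideal.comap θ.toRingHom (Q.map (Polynomial.C : MvPolynomial {j : Fin r // j ≠ i} k →+*
    Polynomial (MvPolynomial {j : Fin r // j ≠ i} k))))

include hθi hP in
omit [P.IsPrime] in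
/-- `T_i ∉ P` (`θ T_i = Z ∉ Q[Z]`). [folklore] -/
theorem X_notMem_comapCone : (X i : S) ∉ P := by
  rw [hP, Ideal.mem_comap, Ideal.mem_map_C_iff]
  intro h
  have h1 := h 1
  rw [AlgHom.toRingHom_eq_coe, RingHom.coe_coe, hθi, Polynomial.coeff_X_one] at h1
  exact (inferInstance : Q.IsPrime).ne_top ((Ideal.eq_top_iff_one Q).mpr h1)

include hθi hθj hP in
omit [P.IsPrime] in
/-- `P ⊆ 𝔫 = (T₀, …, T_{r-1})`: the constant term of `s ∈ P` is the constant term of `θ s ∈ Q[Z]`, an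
element of `Q ∩ k = 0`. [folklore] -/
theorem comapCone_le : P ≤ Ideal.span (Set.range (X : Fin r → S)) := by
  intro s hs
  rw [hP] at hs
  rw [FInjectiveMacaulayfication.Fedder.span_range_X_eq_ker, RingHom.mem_ker]
  -- `Z ↦ 0` after `θ` is `s ↦ s(0)`
  have hcomp : ((Polynomial.evalRingHom (0 : B)).comp (θ).toRingHom : S →+* B) =
      (C : k →+* B).comp constantCoeff := by
    refine ringHom_ext (fun c => ?_) (fun j => ?_)
    · have h1 : θ (C c) = Polynomial.C (C c) := θ.commutes c
      change Polynomial.eval 0 (θ (C c)) = C (constantCoeff (C c))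
      rw [h1, Polynomial.eval_C, constantCoeff_C]
    · change Polynomial.eval 0 (θ (X j)) = C (constantCoeff (X j))
      rw [constantCoeff_X, map_zero]
      by_cases hj : j = i
      · subst hj
        rw [hθi]
        exact Polynomial.eval_X
      · rw [hθj ⟨j, hj⟩, Polynomial.eval_mul, Polynomial.eval_X, zero_mul]
  have h2 : Polynomial.eval 0 (θ s) = C (constantCoeff s) := RingHom.congr_fun hcomp s
  have h3 : (θ s).coeff 0 ∈ Q := Ideal.mem_map_C_iff.mp (Ideal.mem_comap.mp hs) 0
  rw [Polynomial.coeff_zero_eq_eval_zero, h2] at h3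
  by_contra hne
  exact (inferInstance : Q.IsPrime).ne_top
    (Q.eq_top_of_isUnit_mem h3 ((isUnit_iff_ne_zero.mpr hne).map C))

/-! ## The chart inside the local ring of the cone: `ψ : B → S_P`, `T_j ↦ T_j / T_i` -/

local notation3 "L" => Localization.AtPrime P

include hθi hP in
/-- `T_i / 1` is a unit of `S_P`. [folklore] -/
theorem isUnit_algebraMap_X : IsUnit (algebraMap S L (X i)) :=
  (IsLocalization.AtPrime.isUnit_to_map_iff L P (X i)).mpr (X_notMem_comapCone i θ hθi Q P hP)

variable (v : Localization.AtPrime P)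
  (hv : v * algebraMap (MvPolynomial (Fin r) k) (Localization.AtPrime P) (X i) = 1)
  (ψ : MvPolynomial {j : Fin r // j ≠ i} k →ₐ[k] Localization.AtPrime P)
  (hψ : ∀ j : {j : Fin r // j ≠ i}, ψ (X j) = v * algebraMap (MvPolynomial (Fin r) k)
    (Localization.AtPrime P) (X j.1))

include hv hψ in
/-- `ψ` on a form `h ∈ B` of degree `d`: `(T_i/1)^d · ψ(h) = h(T)/1`. [folklore] -/
theorem pow_mul_psi_of_isHomogeneous {h : B} {d : ℕ} (hh : h.IsHomogeneous d) :
    algebraMap S L (X i) ^ d * ψ h = algebraMap S L (rename Subtype.val h) := by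
  have hcomp : ψ = aeval fun j : {j : Fin r // j ≠ i} => v * algebraMap S L (X j.1) :=
    algHom_ext fun j => by rw [hψ, aeval_X]
  have hC : (eval₂Hom (algebraMap k L) fun j : {j : Fin r // j ≠ i} => algebraMap S L (X j.1)) =
      (algebraMap S L).comp (rename (Subtype.val : {j : Fin r // j ≠ i} → Fin r) :
        B →ₐ[k] S).toRingHom := by
    refine ringHom_ext (fun c => ?_) (fun j => ?_)
    · rw [eval₂Hom_C, IsScalarTower.algebraMap_apply k S L c]
      change _ = algebraMap S L (rename Subtype.val (C c))
      rw [rename_C, algebraMap_eq]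
    · rw [eval₂Hom_X']
      change _ = algebraMap S L (rename Subtype.val (X j))
      rw [rename_X]
  have h1 : ψ h = v ^ d * algebraMap S L (rename Subtype.val h) := by
    rw [hcomp, aeval_def, eval₂_mul_of_isHomogeneous _ _ _ hh, ← coe_eval₂Hom, hC]
    rfl
  rw [h1, ← mul_assoc, ← mul_pow, mul_comm _ v, hv, one_pow, one_mul]

include hv hψ in
/-- `ψ` after dehomogenization: `(T_i/1)^D · ψ(kill H) = H/1` for a form `H ∈ S` of degree `D`.
[folklore] -/
theorem pow_mul_psi_kill {H : S} {D : ℕ} (hH : H.IsHomogeneous D) :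
    algebraMap S L (X i) ^ D * ψ (aeval kill H) = algebraMap S L H := by
  have hcomp : (ψ.comp (aeval kill) : S →ₐ[k] L) =
      aeval fun j : Fin r => v * algebraMap S L (X j) := by
    refine algHom_ext fun j => ?_
    rw [AlgHom.comp_apply, aeval_X, aeval_X]
    by_cases hj : j = i
    · subst hj
      rw [dif_pos rfl, map_one, hv]
    · rw [dif_neg hj, hψ]
  have hC : (eval₂Hom (algebraMap k L) fun j : Fin r => algebraMap S L (X j)) = algebraMap S L := by
    refine ringHom_ext (fun c => ?_) (fun j => ?_)
    · rw [eval₂Hom_C, IsScalarTower.algebraMap_apply k S L c, algebraMap_eq]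
    · rw [eval₂Hom_X']
  have h1 : ψ (aeval kill H) = (ψ.comp (aeval kill)) H := rfl
  rw [h1, hcomp, aeval_def, eval₂_mul_of_isHomogeneous _ _ _ hH, ← coe_eval₂Hom, hC, ← mul_assoc,
    ← mul_pow, mul_comm _ v, hv, one_pow, one_mul]

/-! ## Homogenization: `Q ↦ P S_P`, `B ∖ Q ↦ units` -/

/-- The homogenization `bʰ = Σ_d T_i^{D-d} b_d ∈ S` of `b ∈ B` (`D = deg b`, `b_d` its homogeneous
components). -/
local notation3 "hom[" b "]" => ∑ d ∈ Finset.range (MvPolynomial.totalDegree b + 1),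
    (MvPolynomial.X i : MvPolynomial (Fin r) k) ^ (MvPolynomial.totalDegree b - d) *
      MvPolynomial.rename (Subtype.val : {j : Fin r // j ≠ i} → Fin r) (MvPolynomial.homogeneousComponent d b)

include hθi hθj in
/-- `θ(bʰ) = Z^D · b`. [folklore] -/
theorem cone_homogenize (b : B) : θ (hom[b]) = Polynomial.X ^ b.totalDegree * Polynomial.C b := by
  rw [map_sum]
  have : ∀ d ∈ Finset.range (b.totalDegree + 1),
      θ (X i ^ (b.totalDegree - d) * rename Subtype.val (homogeneousComponent d b)) =
        Polynomial.X ^ b.totalDegree * Polynomial.C (homogeneousComponent d b) := by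
    intro d hd
    rw [map_mul, map_pow, hθi, cone_rename_of_isHomogeneous i θ hθj (homogeneousComponent_isHomogeneous d b),
      ← mul_assoc, pow_sub_mul_pow _ (Nat.lt_succ_iff.mp (Finset.mem_range.mp hd))]
  rw [Finset.sum_congr rfl this, ← Finset.mul_sum, ← map_sum, sum_homogeneousComponent]

include hv hψ in
/-- `bʰ/1 = (T_i/1)^D · ψ(b)` in `S_P`. [folklore] -/
theorem algebraMap_homogenize (b : B) :
    algebraMap S L (hom[b]) = algebraMap S L (X i) ^ b.totalDegree * ψ b := by
  rw [map_sum]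
  have : ∀ d ∈ Finset.range (b.totalDegree + 1),
      algebraMap S L (X i ^ (b.totalDegree - d) * rename Subtype.val (homogeneousComponent d b)) =
        algebraMap S L (X i) ^ b.totalDegree * ψ (homogeneousComponent d b) := by
    intro d hd
    rw [map_mul, map_pow, ← pow_mul_psi_of_isHomogeneous i P v hv ψ hψ (homogeneousComponent_isHomogeneous d b),
      ← mul_assoc, pow_sub_mul_pow _ (Nat.lt_succ_iff.mp (Finset.mem_range.mp hd))]
  rw [Finset.sum_congr rfl this, ← Finset.mul_sum, ← map_sum, sum_homogeneousComponent]

include hθi hθj hP hv hψ in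
/-- `ψ(Q) ⊆ P S_P`: for `b ∈ Q`, `θ(bʰ) = Z^D b ∈ Q[Z]`, so `bʰ ∈ P` and `(T_i/1)^D ψ(b) = bʰ/1 ∈ P S_P`.
[folklore] -/
theorem psi_mem_maximalIdeal {b : B} (hb : b ∈ Q) : ψ b ∈ maximalIdeal L := by
  have h1 : hom[b] ∈ P := by
    rw [hP, Ideal.mem_comap, AlgHom.toRingHom_eq_coe, RingHom.coe_coe, cone_homogenize i θ hθi hθj]
    exact Ideal.mul_mem_left _ _ (Ideal.mem_map_of_mem _ hb)
  have h2 : algebraMap S L (hom[b]) ∈ maximalIdeal L :=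
    (IsLocalization.AtPrime.to_map_mem_maximal_iff L P _).mpr h1
  rw [algebraMap_homogenize i P v hv ψ hψ] at h2
  rcases (inferInstance : (maximalIdeal L).IsPrime).mem_or_mem h2 with h | h
  · exact absurd ((isUnit_algebraMap_X i θ hθi Q P hP).pow _) ((IsLocalRing.mem_maximalIdeal _).mp h)
  · exact h

include hθi hθj hP hv hψ in
omit [Q.IsPrime] in
/-- `ψ(B ∖ Q) ⊆ S_Pˣ`: for `b ∉ Q`, `Z^D b ∉ Q[Z]`, so `bʰ ∉ P` and `(T_i/1)^D ψ(b) = bʰ/1` is a unit.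
[folklore] -/
theorem isUnit_psi {b : B} (hb : b ∉ Q) : IsUnit (ψ b) := by
  have h1 : hom[b] ∉ P := by
    rw [hP, Ideal.mem_comap, AlgHom.toRingHom_eq_coe, RingHom.coe_coe, cone_homogenize i θ hθi hθj]
    intro h
    have h2 := Ideal.mem_map_C_iff.mp h (0 + b.totalDegree)
    rw [Polynomial.coeff_X_pow_mul, Polynomial.coeff_C_zero] at h2
    exact hb h2
  have h2 : IsUnit (algebraMap S L (hom[b])) :=
    (IsLocalization.AtPrime.isUnit_to_map_iff L P _).mpr h1
  rw [algebraMap_homogenize i P v hv ψ hψ] at h2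
  exact isUnit_of_mul_isUnit_right h2

/-! ## The transfer -/

include hθi hθj hP hv hψ in
/-- **Fedder's test descends from the vertex of the cone to every point of the chart** (form with the
auxiliary maps `θ`, `ψ` and the prime `P` as parameters). [folklore; Fedder1983 Thm. 1.12 with Kunz
flatness] -/
theorem algebraMap_kill_notMem_frobeniusPower_aux (p : ℕ) [Fact p.Prime] [CharP k p] {D : ℕ} {H : S}
    (hH : H.IsHomogeneous D) (hHn : H ∉ Ideal.span (Set.range fun j : Fin r => (X j : S) ^ p)) :
    algebraMap B (Localization.AtPrime Q) (aeval kill H) ∉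
      frobeniusPower p (maximalIdeal (Localization.AtPrime Q)) := by
  haveI : CharP (Localization.AtPrime Q) p :=
    FInjectiveMacaulayfication.FrobeniusClosedLocalizes.charP_localizationAtPrime p Q
  haveI : CharP L p :=
    FInjectiveMacaulayfication.FrobeniusClosedLocalizes.charP_localizationAtPrime p P
  intro hmem
  -- pull back to `B`: `m · kill H ∈ Q^[p]` for some `m ∉ Q`
  have hmap : frobeniusPower p (maximalIdeal (Localization.AtPrime Q)) =
      (frobeniusPower p Q).map (algebraMap B (Localization.AtPrime Q)) := by
    rw [← Localization.AtPrime.map_eq_maximalIdeal]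
    simpa only [pow_one] using
      FInjectiveMacaulayfication.Fedder.frobeniusPower_map p (algebraMap B (Localization.AtPrime Q)) 1 Q
  rw [hmap, IsLocalization.algebraMap_mem_map_algebraMap_iff Q.primeCompl] at hmem
  obtain ⟨m, hm, hmH⟩ := hmem
  -- push to `S_P` along `ψ`
  have hle : Q.map ψ.toRingHom ≤ maximalIdeal L :=
    Ideal.map_le_iff_le_comap.mpr fun b hb => psi_mem_maximalIdeal i θ hθi hθj Q P hP v hv ψ hψ hb
  have hmapψ : (frobeniusPower p Q).map ψ.toRingHom = frobeniusPower p (Q.map ψ.toRingHom) := by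
    simpa only [pow_one] using
      (FInjectiveMacaulayfication.Fedder.frobeniusPower_map p ψ.toRingHom 1 Q).symm
  have h1 : ψ m * ψ (aeval kill H) ∈ frobeniusPower p (maximalIdeal L) := by
    rw [← map_mul]
    refine frobeniusPower_mono p hle ?_
    rw [← hmapψ]
    exact Ideal.mem_map_of_mem _ hmH
  obtain ⟨w, hw⟩ := (isUnit_psi i θ hθi hθj Q P hP v hv ψ hψ hm).exists_left_inv
  have h2 : ψ (aeval kill H) ∈ frobeniusPower p (maximalIdeal L) := by
    have := Ideal.mul_mem_left _ w h1
    rwa [← mul_assoc, hw, one_mul] at this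
  have h3 : algebraMap S L H ∈ frobeniusPower p (maximalIdeal L) := by
    rw [← pow_mul_psi_kill i P v hv ψ hψ hH]
    exact Ideal.mul_mem_left _ _ h2
  -- Kunz–Fedder transfer along `P ⊆ 𝔫`
  have hHn' : H ∉ frobeniusPower (p ^ 1) (Ideal.span (Set.range (X : Fin r → S))) := by
    rw [frobeniusPower_span, pow_one, ← Set.range_comp]
    exact hHn
  haveI := FInjectiveMacaulayfication.Fedder.isMaximal_span_range_X k r
  have h4 := FRationalResolution.stub_notMem_frobeniusPower_atPrime p S P
    (Ideal.span (Set.range X)) (comapCone_le i θ hθi hθj Q P hP) 1 H hHn'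
  rw [pow_one] at h4
  exact h4 h3

/-- **Fedder's test descends from the vertex of the cone to every point of the chart.** For a form
`H ∈ k[T₀, …, T_{r-1}]` with `H ∉ (T₀^p, …, T_{r-1}^p)` (`char k = p`) and ANY prime `Q` of the chart ring
`B = k[T_j : j ≠ i]`, the image of the dehomogenization `kill H` in `B_Q` does not lie in the Frobenius
power `(Q B_Q)^[p]`. (With `H = F^(p-1)`: the hypersurface `B_Q/(kill F)` passes Fedder's test wherever the
cone `S_𝔫/(F)` does.) The auxiliary maps: `θ = (T_i ↦ Z, T_j ↦ Z T_j)`, `ψ = (T_j ↦ (T_i/1)⁻¹ (T_j/1))`.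
[folklore; Fedder1983 Thm. 1.12 with Kunz flatness] -/
theorem algebraMap_kill_notMem_frobeniusPower (p : ℕ) [Fact p.Prime] [CharP k p] {D : ℕ} {H : S}
    (hH : H.IsHomogeneous D) (hHn : H ∉ Ideal.span (Set.range fun j : Fin r => (X j : S) ^ p)) :
    algebraMap B (Localization.AtPrime Q) (aeval kill H) ∉
      frobeniusPower p (maximalIdeal (Localization.AtPrime Q)) := by
  -- the cone map
  let θ₀ : S →ₐ[k] Polynomial B := aeval fun j : Fin r =>
    if h : j = i then (Polynomial.X : Polynomial B) else Polynomial.X * Polynomial.C (X ⟨j, h⟩)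
  have hθi : θ₀ (X i) = Polynomial.X := by
    simp only [θ₀, aeval_X, dite_true]
  have hθj : ∀ j : {j : Fin r // j ≠ i}, θ₀ (X j.1) = Polynomial.X * Polynomial.C (X j) := fun j => by
    simp only [θ₀, aeval_X, dif_neg j.2]
  clear_value θ₀
  -- the prime of the cone over `Q`
  haveI := isPrime_comapCone i θ₀ Q
  -- the chart map into `S_P`
  obtain ⟨v, hv⟩ := (isUnit_algebraMap_X i θ₀ hθi Q _ rfl).exists_left_inv
  let ψ₀ : B →ₐ[k] Localization.AtPrime (Ideal.comap θ₀.toRingHom (Q.map Polynomial.C)) :=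
    aeval fun j : {j : Fin r // j ≠ i} => v * algebraMap S _ (X j.1)
  have hψ : ∀ j : {j : Fin r // j ≠ i}, ψ₀ (X j) = v * algebraMap S _ (X j.1) := fun j => by
    simp only [ψ₀, aeval_X]
  clear_value ψ₀
  exact algebraMap_kill_notMem_frobeniusPower_aux i θ₀ hθi hθj Q _ rfl v hv ψ₀ hψ p hH hHn

end Chart

/-! ## Registered form -/

/-- **Fedder's test descends from the vertex of a cone to the charts of its `Proj`** (registered
helper-stub form, fully explicit binders; = `algebraMap_kill_notMem_frobeniusPower`): for a field `k` of
characteristic `p`, a form `H ∈ k[T₀, …, T_{r-1}]` with `H ∉ (T₀^p, …, T_{r-1}^p)` and any prime `Q` of the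
chart ring `k[T_j : j ≠ i]`, the dehomogenization `H(T_i := 1)` does not lie in `(Q k[T_j : j ≠ i]_Q)^[p]`.
[folklore; Fedder1983 Thm. 1.12 with Kunz flatness] -/
theorem coneChart_notMem_frobeniusPower (p : ℕ) [Fact p.Prime] (k : Type) [Field k] [CharP k p] (r : ℕ)
    (i : Fin r) (D : ℕ) (H : MvPolynomial (Fin r) k) (hH : H.IsHomogeneous D)
    (hHn : H ∉ Ideal.span (Set.range fun j : Fin r => (MvPolynomial.X j : MvPolynomial (Fin r) k) ^ p))
    (Q : Ideal (MvPolynomial {j : Fin r // j ≠ i} k)) [Q.IsPrime] :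
    algebraMap (MvPolynomial {j : Fin r // j ≠ i} k) (Localization.AtPrime Q)
      (MvPolynomial.aeval (fun j : Fin r => if h : j = i then (1 : MvPolynomial {j : Fin r // j ≠ i} k)
        else MvPolynomial.X ⟨j, h⟩) H) ∉
      Literature.RingTheory.TightClosure.frobeniusPower p (IsLocalRing.maximalIdeal (Localization.AtPrime Q)) :=
  algebraMap_kill_notMem_frobeniusPower i Q p hH hHn

end Summit.ResolutionOfSingularities.ResolutionOfSingularities.Theorems.FRationalModification.MaxMultiplicityCertificateCone

end
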